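import Summits.CriticalPhenomena.CardyFormulaZ2.Theses.ModulusResponse
import Summits.CriticalPhenomena.CardyFormulaZ2.Theorems.CardyIKTransportAnchorByRigidity
import Literature.Probability.Percolation.CardyFormulaConformalInvariance
import Literature.Probability.LatticeModels.CellGridSaddleSymmetry
import Literature.Probability.Percolation.BondPercolationSymmetry

/-!
# Route `ModulusResponse`, support `SquarePinning`: the quarter turn pins the square

Item `stmt-CriticalPhenomena-6473` (decl
`Summit.CriticalPhenomena.CardyFormulaZ2.Theses.ModulusResponse.SquarePinning`), proved
(`squarePinning_proof`): linear-image Cardy for the diagonal stretches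
`S_t z = cosh t · z + i sinh t · z̄` — one real `t` such that the `P_{1/2}` bond-`ℤ²` crossing
probability of `S_t(R)` (G02 recipe `discreteCrossingProb`) tends to `F(η(R))` for every conformal
rectangle `R` — implies `CardyFormulaZ2`.

* `ModulusResponseSquarePinning.preimage_relabel_discreteCrossing`,
  `ModulusResponseSquarePinning.discreteCrossingProb_image_plane` — covariance of G02's bond
  crossing event / probability under any cell symmetry of `ℤ²` (`CellSymmetry`: lattice map +
  plane isometry; the discretisation is transported by `CellGridSaddleSymmetry`, the open graph
  by `BondPercolationSymmetry`, and `P_p` is invariant under graph automorphisms);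
* `ModulusResponseSquarePinning.discreteCrossingProb_image_mul_I`,
  `ModulusResponseSquarePinning.bondDomainCrossingProb_map_mulLeft₀_I` — the quarter turn
  `z ↦ i z` is an exact symmetry of `discreteCrossingProb` / `bondDomainCrossingProb`, mesh by
  mesh (the "remaining formal input" named in the item);
* `squarePinning_proof` — with `K = S_{-t}` as a real-linear automorphism of `ℂ`, the hypothesis
  reads `bondDomainCrossingProb R → F(m(K R))`; the two-ended rigidity theorem
  `anchorByRigidity_proof` (item 4969, route CardyIKTransport: quarter-turn invariance at one
  end, Smirnov's theorem `hasCrossingLimit_triDomainCrossingProb_holds` as comparison at the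
  other, Beffara's shear rigidity in between) forces `K` to be a similarity and yields Cardy
  limits for `bondDomainCrossingProb R`, i.e. `CardyFormulaZ2`.

References: V. Beffara, *Is critical 2D percolation universal?* (2008), Prop. 4 and §2.2 (the
order-4 symmetry of `ℤ²` pins the modulus); S. Smirnov, C. R. Acad. Sci. Paris 333 (2001).
-/

noncomputable section

open Set Filter Topology Complex MeasureTheory
open UpperHalfPlane (upperHalfPlaneSet)
open scoped ComplexConjugate
open Literature.Probability.RandomPlanarGeometry
open Literature.Probability.LatticeModels
open Literature.Probability.Percolation hiding cardyFunction

namespace Summit.CriticalPhenomena.CardyFormulaZ2.Theorems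

namespace ModulusResponseSquarePinning

/-- **Covariance of the bond crossing event under a cell symmetry.** For a cell symmetry `s` of
`ℤ²` (lattice map `s.cell`, plane isometry `s.plane`), relabelling the bond configuration along
`s.cell` carries G02's crossing event `C_δ(Ω; A, B)` to `C_δ(s.plane Ω; s.plane A, s.plane B)`:
the discrete domain, its graph and the discrete arcs are transported
(`CellSymmetry.image_cell_discreteArc`, `CellSymmetry.discreteDomainGraph_adj_cell`) and so is
the open graph (`openGraph_relabel_adj_iff`). -/
theorem preimage_relabel_discreteCrossing (s : CellSymmetry) (Ω : Set ℂ) (δ : ℝ) (A B : Set ℂ) :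
    BondConfig.relabel (sym2Equiv s.cell) ⁻¹'
        discreteCrossing (s.plane '' Ω) δ (s.plane '' A) (s.plane '' B) =
      discreteCrossing Ω δ A B := by
  ext ω
  -- the symmetry as an isomorphism of the graphs in which the crossing paths live
  let φ : openGraph ω ⊓ discreteDomainGraph Ω δ ≃g
      openGraph (BondConfig.relabel (sym2Equiv s.cell) ω) ⊓ discreteDomainGraph (s.plane '' Ω) δ :=
    { toEquiv := s.cell
      map_rel_iff' := fun {a b} ↦ by
        rw [SimpleGraph.inf_adj, SimpleGraph.inf_adj, openGraph_relabel_adj_iff,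
          s.discreteDomainGraph_adj_cell] }
  rw [Set.mem_preimage, mem_discreteCrossing_iff, mem_discreteCrossing_iff,
    ← s.image_cell_discreteArc, ← s.image_cell_discreteArc]
  constructor
  · rintro ⟨_, ⟨x, hx, rfl⟩, _, ⟨y, hy, rfl⟩, h⟩
    exact ⟨x, hx, y, hy, (SimpleGraph.Iso.reachable_iff (φ := φ)).1 h⟩
  · rintro ⟨x, hx, y, hy, h⟩
    exact ⟨s.cell x, ⟨x, hx, rfl⟩, s.cell y, ⟨y, hy, rfl⟩,
      (SimpleGraph.Iso.reachable_iff (φ := φ)).2 h⟩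

/-- **Invariance of the bond crossing probability under a cell symmetry**: for every `p`,
`P_p[C_δ(s.plane Ω; s.plane A, s.plane B)] = P_p[C_δ(Ω; A, B)]` (`s.cell` is an automorphism of
`ℤ²`, so `P_p` is invariant under the relabelling, `bondPercolation_real_preimage_relabel_iso`). -/
theorem discreteCrossingProb_image_plane (s : CellSymmetry) (p : unitInterval) (Ω : Set ℂ)
    (δ : ℝ) (A B : Set ℂ) :
    discreteCrossingProb p (s.plane '' Ω) δ (s.plane '' A) (s.plane '' B) =
      discreteCrossingProb p Ω δ A B := by
  let φ : zdGraph 2 ≃g zdGraph 2 :=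
    { toEquiv := s.cell
      map_rel_iff' := fun {a b} ↦ s.zdGraph_adj_cell a b }
  unfold discreteCrossingProb
  rw [← preimage_relabel_discreteCrossing s Ω δ A B]
  exact (bondPercolation_real_preimage_relabel_iso φ p _).symm

/-- **The quarter turn is an exact symmetry of `discreteCrossingProb`**: rotating the domain and
both arcs by `z ↦ i z` does not change the bond-`ℤ²` crossing probability at any mesh `δ` and
any parameter `p` (the quarter turn `CellSymmetry.rot` maps `δℤ²` onto itself). -/
theorem discreteCrossingProb_image_mul_I (p : unitInterval) (Ω : Set ℂ) (δ : ℝ) (A B : Set ℂ) :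
    discreteCrossingProb p ((fun z ↦ I * z) '' Ω) δ ((fun z ↦ I * z) '' A)
        ((fun z ↦ I * z) '' B) =
      discreteCrossingProb p Ω δ A B := by
  rw [← CellSymmetry.image_rot_plane, ← CellSymmetry.image_rot_plane,
    ← CellSymmetry.image_rot_plane]
  exact discreteCrossingProb_image_plane CellSymmetry.rot p Ω δ A B

/-- The bond-`ℤ²` crossing probability of the quarter-turned conformal rectangle `i·R` equals
that of `R`, mesh by mesh (hypothesis (a) of `AnchorByRigidity` for `bondDomainCrossingProb`). -/
theorem bondDomainCrossingProb_map_mulLeft₀_I (R : ConformalRectangle) :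
    bondDomainCrossingProb (R.map (Homeomorph.mulLeft₀ I I_ne_zero)) =
      bondDomainCrossingProb R := by
  funext δ
  simp only [bondDomainCrossingProb, MarkedDomain.carrier_map, MarkedDomain.arc_map,
    Homeomorph.coe_mulLeft₀]
  exact discreteCrossingProb_image_mul_I half R.carrier δ (R.arc 0) (R.arc 2)

end ModulusResponseSquarePinning

open ModulusResponseSquarePinning

/-- **`SquarePinning` — PROVED** (item stmt-CriticalPhenomena-6473 of route `ModulusResponse`):
linear-image Cardy for the diagonal stretches `S_t z = cosh t · z + i sinh t · z̄` (one `t` for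
all conformal rectangles) implies Cardy's formula for bond percolation on `ℤ²` at `p = 1/2`.

Proof. Package `S_{-t} = S_t⁻¹` as a real-linear automorphism `K` of `ℂ` (`cosh² - sinh² = 1`);
the hypothesis says that `bondDomainCrossingProb (K⁻¹ R)` tends to `F(m R)` for every conformal
rectangle `R`, i.e. `bondDomainCrossingProb R → F(m (K R))`. The quarter turn `z ↦ i z` is an
exact symmetry of `bondDomainCrossingProb` at every mesh (`bondDomainCrossingProb_map_mulLeft₀_I`,
from the `D₄`-transport of G02's discretisation and the invariance of `P_{1/2}` under the lattice
rotation), and by Smirnov's theorem (tree: `hasCrossingLimit_triDomainCrossingProb_holds`) the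
site-`𝕋` crossing probabilities of `K R` have the same limit `F(m (K R))`; so the two-ended
rigidity theorem `anchorByRigidity_proof` (item 4969: a quarter-turn invariant family comparing
to site-`𝕋` through a real-linear `K` forces `K` to be a similarity, which preserves moduli)
gives Cardy limits `F(m R)` for `bondDomainCrossingProb R` itself, which is `CardyFormulaZ2`. In
particular `S_{-t}` is a similarity, i.e. `t = 0`, as the informal statement predicts. -/
theorem squarePinning_proof :
    Summit.CriticalPhenomena.CardyFormulaZ2.Theses.ModulusResponse.SquarePinning := by
  unfold Summit.CriticalPhenomena.CardyFormulaZ2.Theses.ModulusResponse.SquarePinning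
  intro hX
  -- the stretches, pinned by their defining formula
  obtain ⟨t, ht⟩ := hX (fun t z ↦ (Real.cosh t : ℂ) * z + I * (Real.sinh t : ℂ) * conj z)
    (fun _ _ ↦ rfl)
  -- `K = S_{-t}` as a real-linear automorphism of `ℂ`, with inverse `S_t`
  obtain ⟨K, hKs⟩ : ∃ K : ℂ ≃L[ℝ] ℂ,
      ∀ z, K.symm z = (Real.cosh t : ℂ) * z + I * (Real.sinh t : ℂ) * conj z := by
    have key : (Real.cosh t : ℂ) ^ 2 - (Real.sinh t : ℂ) ^ 2 = 1 := by
      exact_mod_cast Real.cosh_sq_sub_sinh_sq t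
    refine ⟨{ toFun := fun z ↦ (Real.cosh t : ℂ) * z - I * (Real.sinh t : ℂ) * conj z
              invFun := fun z ↦ (Real.cosh t : ℂ) * z + I * (Real.sinh t : ℂ) * conj z
              map_add' := fun z w ↦ by simp only [map_add]; ring
              map_smul' := fun r z ↦ by
                simp only [RingHom.id_apply, Complex.real_smul, map_mul, Complex.conj_ofReal]
                ring
              left_inv := fun z ↦ by
                simp only [map_sub, map_mul, Complex.conj_I, Complex.conj_ofReal,
                  Complex.conj_conj]
                linear_combination key * z + (Real.sinh t : ℂ) ^ 2 * z * Complex.I_sq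
              right_inv := fun z ↦ by
                simp only [map_add, map_mul, Complex.conj_I, Complex.conj_ofReal,
                  Complex.conj_conj]
                linear_combination key * z + (Real.sinh t : ℂ) ^ 2 * z * Complex.I_sq
              continuous_toFun := by fun_prop
              continuous_invFun := by fun_prop }, fun z ↦ rfl⟩
  -- the hypothesis, rewritten: `bondDomainCrossingProb (K⁻¹ R) → F(m R)` for every `R`
  have himg : ∀ A : Set ℂ,
      (fun z ↦ (Real.cosh t : ℂ) * z + I * (Real.sinh t : ℂ) * conj z) '' A = K.symm '' A :=
    fun A ↦ Set.image_congr fun z _ ↦ (hKs z).symm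
  have hX' : ∀ R : ConformalRectangle,
      R.HasCrossingLimit (bondDomainCrossingProb (R.map K.symm.toHomeomorph)) cardyFunction := by
    intro R
    have h := ht R
    simp only [himg] at h
    have e : bondDomainCrossingProb (R.map K.symm.toHomeomorph) = fun δ ↦
        discreteCrossingProb half (K.symm '' R.carrier) δ (K.symm '' R.arc 0)
          (K.symm '' R.arc 2) := by
      funext δ
      simp only [bondDomainCrossingProb, MarkedDomain.carrier_map, MarkedDomain.arc_map,
        ContinuousLinearEquiv.coe_toHomeomorph]
    rw [e]
    exact h
  -- hypothesis (a) of `AnchorByRigidity`: exact quarter-turn symmetry, mesh by mesh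
  have hqt : ∀ (R : ConformalRectangle) (L : ℝ),
      Tendsto (bondDomainCrossingProb (R.map (Homeomorph.mulLeft₀ I I_ne_zero))) (𝓝[>] 0)
          (𝓝 L) ↔
        Tendsto (bondDomainCrossingProb R) (𝓝[>] 0) (𝓝 L) := fun R L ↦ by
    rw [bondDomainCrossingProb_map_mulLeft₀_I]
  -- hypothesis (b): `bondDomainCrossingProb R` and site-`𝕋` on `K R` have the same limits
  have hKK : K.toHomeomorph.trans K.symm.toHomeomorph = Homeomorph.refl ℂ := by
    ext z
    simp
  have hrefl : ∀ R : ConformalRectangle, R.map (Homeomorph.refl ℂ) = R := fun R ↦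
    MarkedDomain.ext (JordanDomain.ext (by simp) rfl) rfl
  have hcmp : ∀ (R : ConformalRectangle) (L : ℝ),
      Tendsto (bondDomainCrossingProb R) (𝓝[>] 0) (𝓝 L) ↔
        Tendsto (triDomainCrossingProb (R.map K.toHomeomorph)) (𝓝[>] 0) (𝓝 L) := by
    intro R L
    obtain ⟨φ, x, hφ⟩ := MarkedDomain.exists_isUniformizing_holds (R.map K.toHomeomorph)
    have t1 : Tendsto (triDomainCrossingProb (R.map K.toHomeomorph)) (𝓝[>] 0)
        (𝓝 (cardyFunction (crossRatio x))) :=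
      hasCrossingLimit_triDomainCrossingProb_holds (R.map K.toHomeomorph) φ x hφ
    have t2 : Tendsto (bondDomainCrossingProb R) (𝓝[>] 0)
        (𝓝 (cardyFunction (crossRatio x))) := by
      have h := hX' (R.map K.toHomeomorph) φ x hφ
      rwa [MarkedDomain.map_map, hKK, hrefl] at h
    constructor
    · intro h
      rw [tendsto_nhds_unique h t2]
      exact t1
    · intro h
      rw [tendsto_nhds_unique h t1]
      exact t2
  -- two-ended rigidity (`anchorByRigidity_proof`, item 4969) with Smirnov's theorem as phantom
  exact (anchorByRigidity_proof hasCrossingLimit_triDomainCrossingProb_holds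
    bondDomainCrossingProb K hqt hcmp).2

end Summit.CriticalPhenomena.CardyFormulaZ2.Theorems

end
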